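import Literature.NumberTheory.Transcendental.KZDirichletScaling
import Literature.NumberTheory.Transcendental.KZSemialgebraicComplex
import HarnessLib

/-!
# The dilation move of the Kontsevich–Zagier calculus

Kontsevich–Zagier's rule (2) (change of variables, `KZ.changeOfVariablesRel`) instantiated ONCE, in
every dimension `n`, for the dilations `Φ u = s • u` of `ℝⁿ` by a non-zero real-algebraic factor
`s` (in particular a non-zero rational): the certificate
`⟨n, r, r', (s • ·), fun _ => s • id, …⟩ ∈ KZ.changeOfVariablesRel` with

* semialgebraicity — each coordinate `u ↦ s * u j` is the product of the algebraic constant `s`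
  (`isSemialgebraicFunOn_const_of_isAlgebraic`) and a coordinate polynomial;
* derivative — `(hasFDerivAt_id u).const_smul s`;
* injectivity — `smul_right_injective`;
* Jacobian — `|det (s • id)| = |s| ^ n` (`KZ.det_smul_id_fin`).

What is left to a user is the "finite core" of a dilation step: the image identity
`r'.domain = s • r.domain` and the scalar identity `f x = f' (s • x) · |s|ⁿ` on `r.domain`.

## Main statements (namespace `Literature.NumberTheory.Transcendental.KZ`)

* `smul_sub_mem_changeOfVariablesRel` — `[r] − [r'] ∈ changeOfVariablesRel` for an algebraic
  dilation factor `s ≠ 0`; `smul_sub_mem_relations` — hence `∈ relations`;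
* `ratCast_smul_sub_mem_changeOfVariablesRel`, `ratCast_smul_sub_mem_relations` — the rational
  dilations `s : ℚ`, `s ≠ 0`.

Consumers: the scaling moves of one-dimensional carriers (`[(a,b), c/y] ≡ [(sa,sb), c/y]`,
`Summits/…/HurwitzMicroSectorsNormalFormPrincipleDlogMoves.lean`), the simplex dilation of
`KZDirichletScaling.lean` (`σ = (m+1) u`), and the many `1`-dimensional `det_smul_id_fin_one`
re-derivations under `Summits/KontsevichZagierPeriods`.

## References

* M. Kontsevich, D. Zagier, *Periods* (2001), §1.2, rule (2).
* A. Huber, S. Müller-Stach, *Periods and Nori Motives* (2017), §13.1.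

Everything is proved; no `def`, no named fact.
-/

noncomputable section

open MeasureTheory Set
open Literature.ModelTheory.ExponentialFields (IsSemialgebraic)
open MvPolynomial (aeval X C)

namespace Literature.NumberTheory.Transcendental

namespace KZ

variable {n : ℕ}

/-- The dilation `u ↦ s • u` of `ℝⁿ` by a real-algebraic factor `s` is a `ℚ`-semialgebraic map on
every `ℚ`-semialgebraic set. [cite: BCR1998, §2.2] -/
theorem isSemialgebraicMapOn_smul {σ : Set (Fin n → ℝ)} (hσ : IsSemialgebraic ℚ σ) {s : ℝ}
    (hs : IsAlgebraic ℚ s) : IsSemialgebraicMapOn ℚ σ (fun u : Fin n → ℝ => s • u) := by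
  refine IsSemialgebraicMapOn.of_forall hσ fun j => ?_
  have hj : IsSemialgebraicFunOn ℚ σ (fun u : Fin n → ℝ => u j) := by
    simpa only [MvPolynomial.aeval_X] using
      isSemialgebraicFunOn_aeval hσ (X j : MvPolynomial (Fin n) ℚ)
  have h := IsSemialgebraicFunOn.mul_holds (isSemialgebraicFunOn_const_of_isAlgebraic hσ hs) hj
  exact h.congr fun u _ => by simp only [Pi.mul_apply, Pi.smul_apply, smul_eq_mul]

/-- **The dilation move** (Kontsevich–Zagier's rule (2) along `u ↦ s • u`). For a non-zero
real-algebraic `s` and representations `r`, `r'` of dimension `n` with `r'.domain = s • r.domain`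
and `r.integrand x = r'.integrand (s • x) · |s|ⁿ` on `r.domain`, the difference `[r] − [r']` is an
element of `KZ.changeOfVariablesRel`; the witness is `Φ = (s • ·)`, `Φ' = s • id`
(`|det Φ'| = |s|ⁿ`). [cite: KontsevichZagier2001, §1.2 rule (2)] -/
theorem smul_sub_mem_changeOfVariablesRel {s : ℝ} (hs : IsAlgebraic ℚ s) (hs0 : s ≠ 0)
    (r r' : IntegralRep n) (hdom : r'.domain = (fun u : Fin n → ℝ => s • u) '' r.domain)
    (hint : ∀ x ∈ r.domain, r.integrand x = r'.integrand (s • x) * |s| ^ n) :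
    of r - of r' ∈ changeOfVariablesRel := by
  refine ⟨n, r, r', fun u => s • u, fun _ => s • ContinuousLinearMap.id ℝ (Fin n → ℝ),
    isSemialgebraicMapOn_smul r.isSemialgebraic_domain hs,
    fun u _ => ((hasFDerivAt_id u).const_smul s).hasFDerivWithinAt,
    fun u _ v _ h => smul_right_injective (Fin n → ℝ) hs0 h, hdom, fun x hx => ?_, rfl⟩
  rw [hint x hx, det_smul_id_fin, abs_pow]

/-- The dilation move lands in `KZ.relations`: under the hypotheses of
`smul_sub_mem_changeOfVariablesRel`, `[r] − [r'] ∈ relations` (i.e. `r` and `r'` are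
KZ-equivalent). [cite: KontsevichZagier2001, §1.2 rule (2)] -/
theorem smul_sub_mem_relations {s : ℝ} (hs : IsAlgebraic ℚ s) (hs0 : s ≠ 0)
    (r r' : IntegralRep n) (hdom : r'.domain = (fun u : Fin n → ℝ => s • u) '' r.domain)
    (hint : ∀ x ∈ r.domain, r.integrand x = r'.integrand (s • x) * |s| ^ n) :
    of r - of r' ∈ relations :=
  changeOfVariablesRel_subset_relations (smul_sub_mem_changeOfVariablesRel hs hs0 r r' hdom hint)

/-- The dilation move for a non-zero **rational** factor `s`: `[r] − [r'] ∈ changeOfVariablesRel`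
when `r'.domain = s • r.domain` and `r.integrand x = r'.integrand (s • x) · |s|ⁿ` on `r.domain`.
[cite: KontsevichZagier2001, §1.2 rule (2)] -/
theorem ratCast_smul_sub_mem_changeOfVariablesRel {s : ℚ} (hs : s ≠ 0) (r r' : IntegralRep n)
    (hdom : r'.domain = (fun u : Fin n → ℝ => (s:ℝ) • u) '' r.domain)
    (hint : ∀ x ∈ r.domain, r.integrand x = r'.integrand ((s:ℝ) • x) * |(s:ℝ)| ^ n) :
    of r - of r' ∈ changeOfVariablesRel :=
  smul_sub_mem_changeOfVariablesRel (s := (s:ℝ)) (isAlgebraic_algebraMap s) (by exact_mod_cast hs)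
    r r' hdom hint

/-- The dilation move for a non-zero **rational** factor `s` lands in `KZ.relations`.
[cite: KontsevichZagier2001, §1.2 rule (2)] -/
theorem ratCast_smul_sub_mem_relations {s : ℚ} (hs : s ≠ 0) (r r' : IntegralRep n)
    (hdom : r'.domain = (fun u : Fin n → ℝ => (s:ℝ) • u) '' r.domain)
    (hint : ∀ x ∈ r.domain, r.integrand x = r'.integrand ((s:ℝ) • x) * |(s:ℝ)| ^ n) :
    of r - of r' ∈ relations :=
  changeOfVariablesRel_subset_relations (ratCast_smul_sub_mem_changeOfVariablesRel hs r r' hdom hint)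

end KZ

end Literature.NumberTheory.Transcendental
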